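import Summits.ABC.IUTFork.Cor312LicenceDeepReal
import Summits.ABC.IUTFork.Cor312VolumesPadicLatticeScaled
import Literature.IUT.LogVolume.TensorPacketContentBounds
import HarnessLib

/-!
# [IUTchIII] Cor. 3.12 — an (Ind1),(Ind2)-STABLE summand-wise scaled log-shell lattice around the sharp Θ-region at ANY prime,
# with an EXPLICIT [IUTchIV] Prop. 1.2 scalar at ONE chosen diagonal summand (lattice half of «C-SH-EXPLICIT-DEPTH»)

PROOF-ONLY support piece (D-0012; 0 definitions, 0 `Prop` facts) of the abc-iut cell (WAVE-4 D-0067 cone-interior prover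
abc-iut-w4-d092, gen 5; row «C-SH-EXPLICIT-DEPTH», part 1 of 2 — part 2 `Cor312LicenceExplicitDepth` draws the consequences for
the (xi-f) licence and branch C's S_H antecedent). TAKES NO SIDE on [IUTchIII] Cor. 3.12 or on any author: statements about OUR typed
objects (abc-iut-c312-5's `logShellsDH` / `PadicPresentation`, abc-iut-c312-3's SHARP idele boxes `sharpBoxDH`, abc-iut-c312-3/c312-7's
`Real.settingDHVolSharp`); typed ≠ proved; instantiated ≠ endorsed.

§1 (campaign-S vocabulary, any finite family `k` of `p`-adic fields): `log_p(R_I^×) ⊆ I_{v⃗}` (`logPacket_subset_logShell`); the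
prime-uniform bound `‖(2p)^{−|I|}‖_p ≤ p^{2|I|}` (`norm_shellScalar_le`); the OUTER radius of `c·I_{v⃗}` in the field-factor
coordinates `ψ` — every coordinate has norm `≤ ‖c‖·‖(2p)^{−|I|}‖·p^{b_I}` ([IUTchIV] Prop. 1.2 (i): `log_p(R_I^×) ⊆ ⊗h·R_I`,
`‖h_a‖ = p^{b_a}`; `norm_dEquiv_le_of_mem_smul_logShell`); the INNER absorption of a sharp box `ι_i(g)·(R_I)^∼ ⊆
p^{⌊m/e_i − d_I − a_I⌋}·I_{v⃗}` for `‖g‖ = p^{−m/e_i}` ([IUTchIV] Prop. 1.2 (ii) at `φ = id`, abc-iut-S6's `prop12ii_holds` via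
campaign-S `iota_smul_normalizedPacket_subset_zpow_smul_logPacket`); and `‖ψ(y)_J‖ ≤ ‖g‖` on such a box.
§2 (`exists_symm_latticePkS_superset_thetaRegion3_settingDHVolSharp`): at the sharp DH setting, a prime `p` (ANY — ramified or `2`
included), a label `i₀+1` and a place `x₀ | p` with `‖t_{Θ,i₀+1,x₀}‖ = p^{−m_Θ/e}`, there is a capsule-SYMMETRIC, nowhere-zero scalar
function `c` on the summands with `c(x⃗₀) = p^{⌊m_Θ/e − d_I − a_I⌋}` at the DIAGONAL summand `x⃗₀ = (x₀,…,x₀)` (symmetric because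
`x⃗₀ ∘ σ = x⃗₀`; an absorbing constant, abc-iut-c312-5 `exists_latticeF_of_norm_le`, elsewhere) such that the (Ind3)-region lies in
abc-iut-c312-5's scaled lattice `e⁻¹(Π_{v⃗} c(v⃗)·I_{v⃗})` (`latticePkS`) — which EVERY element of `⟨Ind1 ∪ Ind2⟩` maps onto itself
(`image_latticePkS_of_mem_closure_of_symm`). [cite: Mochizuki2012, IUTchIV Prop. 1.2 (i)(ii) p. 10]
[cite: DupuyHilado2025, §3.9, §4 (intro), §4.7, §4.9] [claim: Mochizuki2012, status: disputed]
-/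

noncomputable section

open Set Function
open scoped Pointwise

namespace Summit.ABC

namespace IUTFork

/-! ## §1. Packet-level bounds from the [IUTchIV] Prop. 1.2 sandwich (campaign-S vocabulary) -/

namespace Cor312Vol.ExplicitDepth

open Literature.IUT.LogVolume

variable (p : ℕ) [Fact p.Prime] {I : Type} [Fintype I] [DecidableEq I]
  (k : I → Type) [∀ i, NontriviallyNormedField (k i)] [∀ i, NormedAlgebra ℚ_[p] (k i)]
  [∀ i, IsUltrametricDist (k i)] [∀ i, ProperSpace (k i)]

omit [DecidableEq I] [∀ i, IsUltrametricDist (k i)] [∀ i, ProperSpace (k i)] in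
/-- `log_p(R_I^×) ⊆ I_{v⃗} = (2p)^{−|I|}·log_p(R_I^×)` (the log-shell scalar has `ℤ_p`-integral inverse `(2p)^{|I|}`, and
`log_p(R_I^×)` is an additive subgroup). [cite: DupuyHilado2025, §4 (intro)] -/
theorem logPacket_subset_logShell :
    (logPacket p k : Set (PacketAlgebra p k)) ⊆ logShell p k := by
  intro w hw
  refine Set.mem_smul_set.mpr ⟨((2 * p : ℚ_[p]) ^ Fintype.card I) • w, ?_, ?_⟩
  · have : ((2 * p : ℚ_[p]) ^ Fintype.card I) • w = ((2 * p) ^ Fintype.card I : ℕ) • w := by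
      rw [← Nat.cast_smul_eq_nsmul ℚ_[p]]; push_cast; rfl
    rw [this]
    exact AddSubgroup.nsmul_mem _ hw _
  · rw [shellScalar, smul_smul, inv_mul_cancel₀ (pow_ne_zero _ (mul_ne_zero two_ne_zero
      (by exact_mod_cast (Fact.out : p.Prime).ne_zero))), one_smul]

omit [DecidableEq I] [∀ i, IsUltrametricDist (k i)] [∀ i, ProperSpace (k i)]
  [∀ i, NontriviallyNormedField (k i)] [∀ i, NormedAlgebra ℚ_[p] (k i)] in
/-- **`‖(2p)^{−|I|}‖_p ≤ p^{2|I|}`** (`‖2‖_p ≥ p^{−1}`, with equality iff `p = 2`): a prime-uniform bound on the log-shell scalar.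
[cite: DupuyHilado2025, §4 (intro)] -/
theorem norm_shellScalar_le : ‖shellScalar p (I := I)‖ ≤ (p : ℝ) ^ (2 * Fintype.card I) := by
  have hp0 : (0 : ℝ) < p := by exact_mod_cast (Fact.out : p.Prime).pos
  have h2 : (p : ℝ)⁻¹ ≤ ‖(2 : ℚ_[p])‖ := by
    by_cases hp2 : p = 2
    · subst hp2
      have : ((2 : ℕ) : ℚ_[2]) = (2 : ℚ_[2]) := by norm_cast
      rw [← this, Padic.norm_p]
    · have hcop : p.Coprime 2 := (Nat.coprime_primes (Fact.out : p.Prime) Nat.prime_two).2 hp2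
      have : ‖((2 : ℕ) : ℚ_[p])‖ = 1 := Padic.norm_natCast_eq_one_iff.2 hcop
      rw [Nat.cast_ofNat] at this
      rw [this]
      exact inv_le_one_of_one_le₀ (by exact_mod_cast (Fact.out : p.Prime).one_le)
  have hlow : ((p : ℝ) ^ (2 * Fintype.card I))⁻¹ ≤ ‖(2 * p : ℚ_[p]) ^ Fintype.card I‖ := by
    rw [norm_pow, norm_mul, Padic.norm_p, pow_mul, ← inv_pow, pow_two, mul_inv]
    exact pow_le_pow_left₀ (by positivity) (mul_le_mul_of_nonneg_right h2 (inv_nonneg.2 hp0.le)) _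
  rw [shellScalar, norm_inv]
  have := inv_anti₀ (by positivity) hlow
  rwa [inv_inv] at this

/-- `‖ψ(⊗ h_a)_J‖ = p^{b_I}` for a family `h` realising `p^{−b_I}` (the component embeddings are isometries).
[cite: Mochizuki2012, IUTchIV Prop. 1.2 (i) p. 10] -/
theorem norm_dEquiv_purePacket_of_realizesNegB {h : Π i, k i} (hh : RealizesNegB p k h) (J : DIdx p k) :
    ‖dEquiv p k (purePacket p k h) J‖ = (p : ℝ) ^ bSum p k := by
  rw [psi_purePacket_apply, norm_prod, ← prod_norm_of_realizesNegB p k hh]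
  exact Finset.prod_congr rfl fun i _ => norm_factorEmb p k (DFac p k) (dEquiv p k) i J (h i)

/-- **Outer radius of a scaled log-shell in field-factor coordinates** ([IUTchIV] Prop. 1.2 (i), fourth inclusion
`log_p(R_I^×) ⊆ ⊗h·R_I ⊆ ⊗h·(R_I)^∼` with `‖h_a‖ = p^{b_a}`): every element of `c·I_{v⃗}` has all `ψ`-coordinates of norm
`≤ ‖c‖·‖(2p)^{−|I|}‖·p^{b_I}`. [cite: Mochizuki2012, IUTchIV Prop. 1.2 (i) p. 10] -/
theorem norm_dEquiv_le_of_mem_smul_logShell [Nonempty I] (c : ℚ_[p]) {w : PacketAlgebra p k}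
    (hw : w ∈ c • logShell p k) (J : DIdx p k) :
    ‖dEquiv p k w J‖ ≤ ‖c‖ * ‖shellScalar p (I := I)‖ * (p : ℝ) ^ bSum p k := by
  obtain ⟨h, hh⟩ := exists_realizesNegB p k
  obtain ⟨w₁, hw₁, rfl⟩ := Set.mem_smul_set.mp hw
  obtain ⟨w₂, hw₂, rfl⟩ := Set.mem_smul_set.mp hw₁
  obtain ⟨y, hy, rfl⟩ := exists_mem_integerPacket_of_mem_logPacket p k hh hw₂
  have hyO : y ∈ (normalizedPacket p k : Set (PacketAlgebra p k)) := integerPacket_le_normalizedPacket p k hy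
  have hyJ : ‖dEquiv p k y J‖ ≤ 1 := by
    have hmem : dEquiv p k y ∈ dEquiv p k '' (normalizedPacket p k : Set (PacketAlgebra p k)) := ⟨y, hyO, rfl⟩
    rw [image_normalizedPacket_eq_coe, coe_piUnitBallStructure, mem_polydisc] at hmem
    exact hmem J
  rw [map_smul, map_smul, Pi.smul_apply, Pi.smul_apply, norm_smul, norm_smul, map_mul, Pi.mul_apply, norm_mul,
    norm_dEquiv_purePacket_of_realizesNegB p k hh]
  calc ‖c‖ * (‖shellScalar p (I := I)‖ * ((p : ℝ) ^ bSum p k * ‖dEquiv p k y J‖))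
      ≤ ‖c‖ * (‖shellScalar p (I := I)‖ * ((p : ℝ) ^ bSum p k * 1)) := by gcongr
    _ = ‖c‖ * ‖shellScalar p (I := I)‖ * (p : ℝ) ^ bSum p k := by ring

/-- **Inner absorption of a sharp box** ([IUTchIV] Prop. 1.2 (ii) at `φ = id`, campaign-S
`iota_smul_normalizedPacket_subset_zpow_smul_logPacket`, then `log_p(R_I^×) ⊆ I_{v⃗}`): for `‖g‖ = p^{−m/e_i}` and `|I| ≥ 2`,
`ι_i(g)·(R_I)^∼ ⊆ p^{⌊m/e_i − d_I − a_I⌋}·I_{v⃗}`. [cite: Mochizuki2012, IUTchIV Prop. 1.2 (ii) p. 10] -/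
theorem iota_smul_normalizedPacket_subset_zpow_smul_logShell (hI : 2 ≤ Fintype.card I) {i : I} {m : ℤ} {g : k i}
    (hg : ‖g‖ = (p : ℝ) ^ (-((m : ℝ) / absRamificationIdx p (k i)))) :
    iota p k i g • (normalizedPacket p k : Set (PacketAlgebra p k)) ⊆
      ((p : ℚ_[p]) ^ ⌊(m : ℝ) / absRamificationIdx p (k i) - dSum p k - aSum p k⌋) •
        logShell p k :=
  (iota_smul_normalizedPacket_subset_zpow_smul_logPacket p k hI hg).trans
    (Set.smul_set_mono (logPacket_subset_logShell p k))

/-- The `ψ`-coordinates of a point of the sharp box `ι_i(g)·(R_I)^∼` have norm `≤ ‖g‖` (`ψ((R_I)^∼)` is the unit polydisc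
and `‖ψ(ι_i g)_J‖ = ‖g‖`). [cite: Mochizuki2012, IUTchIV Prop. 1.4 (i) p. 13] -/
theorem norm_dEquiv_le_of_mem_iota_smul_normalizedPacket [Nonempty I] {i : I} (g : k i) {w : PacketAlgebra p k}
    (hw : w ∈ iota p k i g • (normalizedPacket p k : Set (PacketAlgebra p k))) (J : DIdx p k) :
    ‖dEquiv p k w J‖ ≤ ‖g‖ := by
  obtain ⟨y, hy, rfl⟩ := Set.mem_smul_set.mp hw
  have hyJ : ‖dEquiv p k y J‖ ≤ 1 := by
    have hmem : dEquiv p k y ∈ dEquiv p k '' (normalizedPacket p k : Set (PacketAlgebra p k)) := ⟨y, hy, rfl⟩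
    rw [image_normalizedPacket_eq_coe, coe_piUnitBallStructure, mem_polydisc] at hmem
    exact hmem J
  rw [smul_eq_mul, map_mul, Pi.mul_apply, norm_mul, norm_dEquiv_iota]
  calc ‖g‖ * ‖dEquiv p k y J‖ ≤ ‖g‖ * 1 := by gcongr
    _ = ‖g‖ := mul_one _

end Cor312Vol.ExplicitDepth

end IUTFork

end Summit.ABC


/-! ## §2. At the sharp real settings: the stable lattice at ONE diagonal summand -/

namespace Summit.ABC.IUTFork.Thm311.Real

open Cor312 Cor312.Setting Cor312Vol Cor312Vol.ExplicitDepth Literature.IUT.LogThetaLattice Literature.IUT.LogVolume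
  NumberField IsDedekindDomain

variable {F : Type} [Field F] [NumberField F] (X : PilotData F) {logv : PadicLogs F} (hlog : LogvAnalytic logv)
  (M : Type) [Field M] [NumberField M]
  (archPk : ∀ (j : (thetaIndex X).Label) (vQ : (thetaIndex X).VQ), Set ((logShellsDH X logv).Packet j vQ))
  (archSub : ∀ (j : (thetaIndex X).Label) (v : (thetaIndex X).V),
    Set ((logShellsDH X logv).Packet j ((thetaIndex X).over v)))
  (Ψ : ℤ → ∀ v : (thetaIndex X).V, v ∈ (thetaIndex X).Vbad → Set ((logShellsDH X logv).StarPacket v))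
  (act : ℤ → ∀ v : (thetaIndex X).V, v ∈ (thetaIndex X).Vbad →
    (logShellsDH X logv).StarPacket v → Module.End ℚ ((logShellsDH X logv).StarPacket v))
  (Mmod : ℤ → ∀ j : (thetaIndex X).LabelStar, Set ((logShellsDH X logv).GlobalPacket j.1))
  (region : ℤ → ∀ j : (thetaIndex X).LabelStar, FinDivisor M → ∀ vQ : (thetaIndex X).VQ,
    Set ((logShellsDH X logv).Packet j.1 vQ))
  (n : ℤ) {HT : Type} {LogLink : HT → HT → Type} {IsFull : ∀ {s t : HT}, LogLink s t → Prop}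
  (lat : LGPGaussianLogThetaLattice LogLink IsFull)
  {Frd : Type} {IsoF : Frd → Frd → Type} {Ob : Frd → Type} {realify : Frd → Frd} {Strip : Type}
  {IsoS : Strip → Strip → Type} {Mv : ∀ v : (thetaIndex X).V, v ∈ (thetaIndex X).Vbad → Type}
  [∀ v h, Monoid (Mv v h)]
  (sig : GlobalLGPFrobenioidSignature (thetaIndex X).lstar (thetaIndex X).V (· ∈ (thetaIndex X).Vbad)
    Frd IsoF Ob realify Strip IsoS Mv)
  (split : SplittingMonoids Mv) {ObΔ : Type} {N : ∀ v : (thetaIndex X).V, v ∈ (thetaIndex X).Vbad → Type}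
  [∀ v h, Monoid (N v h)] (qData : QPilotData ObΔ N)
  (tq : ∀ (pp : Nat.Primes) (x : (thetaIndex X).Fibre (.inr pp)), haveI : Fact (pp : ℕ).Prime := ⟨pp.2⟩; kOf X pp.1 x)
  (t : ∀ (pp : Nat.Primes) (_ : Fin X.lstar) (x : (thetaIndex X).Fibre (.inr pp)),
    haveI : Fact (pp : ℕ).Prime := ⟨pp.2⟩; kOf X pp.1 x)
  (htq0 : ∀ pp x, tq pp x ≠ 0)
  (htq1 : ∀ (pp : Nat.Primes) (x : (thetaIndex X).Fibre (.inr pp)),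
    haveI : Fact (pp : ℕ).Prime := ⟨pp.2⟩; placeOf X pp.1 x ∉ X.S → ‖tq pp x‖ = 1)

/-- **The (Ind3)-region of the sharp DH setting at `(i₀+1, p)` lies in a capsule-SYMMETRIC summand-wise scaled log-shell
lattice whose scalar at the DIAGONAL summand `x⃗₀ = (x₀,…,x₀)` is `p^{⌊m_Θ/e − d_I − a_I⌋}`** (`‖t_{Θ,i₀+1,x₀}‖ = p^{−m_Θ/e}`;
[IUTchIV] Prop. 1.2 (ii) at `φ = id` for the diagonal box, an absorbing constant `C` at every other summand). PROVED.
[cite: Mochizuki2012, IUTchIV Prop. 1.2 (ii) p. 10] [cite: DupuyHilado2025, §3.9, §4 (intro)] -/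
theorem exists_symm_latticePkS_superset_thetaRegion3_settingDHVolSharp (pp : Nat.Primes) (i₀ : Fin (thetaIndex X).lstar)
    (x₀ : (thetaIndex X).Fibre (.inr pp)) (mΘ : ℤ)
    (hΘ : haveI : Fact (pp : ℕ).Prime := ⟨pp.2⟩
      ‖t pp i₀ x₀‖ = ((pp : ℕ) : ℝ) ^ (-((mΘ : ℝ) / absRamificationIdx (pp : ℕ) (kOf X pp.1 x₀)))) :
    haveI : Fact (pp : ℕ).Prime := ⟨pp.2⟩
    ∃ c : ((thetaIndex X).Caps (labelSucc i₀) → (thetaIndex X).Fibre (.inr pp)) → ℚ_[pp],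
      (∀ (σ : Equiv.Perm ((thetaIndex X).Caps (labelSucc i₀))) e, c (e ∘ ⇑σ) = c e) ∧ (∀ e, c e ≠ 0) ∧
      c (fun _ => x₀) = ((pp : ℕ) : ℚ_[pp]) ^
        ⌊(mΘ : ℝ) / absRamificationIdx (pp : ℕ) (kOf X pp.1 x₀)
          - dSum (pp : ℕ) ((presAt X hlog pp).kk (fun _ : (thetaIndex X).Caps (labelSucc i₀) => x₀))
          - aSum (pp : ℕ) ((presAt X hlog pp).kk (fun _ : (thetaIndex X).Caps (labelSucc i₀) => x₀))⌋ ∧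
      (settingDHVolSharp X hlog M archPk archSub Ψ act Mmod region n lat sig split qData tq t htq0 htq1).thetaRegion3
          (labelSucc i₀) (.inr pp) ⊆ (presAt X hlog pp).latticePkS (labelSucc i₀) c := by
  haveI : Fact (pp : ℕ).Prime := ⟨pp.2⟩
  classical
  set P := presAt X hlog pp with hP
  set j : (thetaIndex X).Label := labelSucc i₀ with hj
  set e₀ : (thetaIndex X).Caps j → (thetaIndex X).Fibre (.inr pp) := fun _ => x₀ with he₀
  set n₀ : ℤ := ⌊(mΘ : ℝ) / absRamificationIdx (pp : ℕ) (kOf X pp.1 x₀) - dSum (pp : ℕ) (P.kk e₀) -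
    aSum (pp : ℕ) (P.kk e₀)⌋ with hn₀
  -- an absorbing constant for all the boxes at this packet
  obtain ⟨xM, hxM⟩ := Finite.exists_max fun x : (thetaIndex X).Fibre (.inr pp) => ‖t pp i₀ x‖
  obtain ⟨C, hC0, hC⟩ := P.exists_latticeF_of_norm_le (j := j) ‖t pp i₀ xM‖
  have hpQ : ((pp : ℕ) : ℚ_[pp]) ≠ 0 := Nat.cast_ne_zero.mpr pp.2.ne_zero
  refine ⟨fun e => if e = e₀ then ((pp : ℕ) : ℚ_[pp]) ^ n₀ else C, fun σ e => ?_, fun e => ?_, by simp [he₀], ?_⟩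
  rotate_left
  · -- nondegenerate scalars
    show (if e = e₀ then ((pp : ℕ) : ℚ_[pp]) ^ n₀ else C) ≠ 0
    split_ifs
    · exact zpow_ne_zero _ hpQ
    · exact hC0
  rotate_right
  · -- capsule symmetry: `x⃗₀ ∘ σ = x⃗₀`, and `e ∘ σ = x⃗₀` forces `e = x⃗₀`
    have hfix : ∀ e : (thetaIndex X).Caps j → (thetaIndex X).Fibre (.inr pp), e ∘ ⇑σ = e₀ ↔ e = e₀ := by
      intro e
      constructor
      · intro h
        funext a
        have := congrFun h (σ.symm a)
        rw [Function.comp_apply, Equiv.apply_symm_apply] at this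
        rw [this, he₀]
      · intro h
        subst h
        funext a
        simp only [Function.comp_apply, he₀]
    show (if e ∘ ⇑σ = e₀ then ((pp : ℕ) : ℚ_[pp]) ^ n₀ else C) = (if e = e₀ then ((pp : ℕ) : ℚ_[pp]) ^ n₀ else C)
    rw [if_congr (hfix e) rfl rfl]
  · -- the (Ind3)-region is `e⁻¹(Π_{v⃗} box_{v⃗})`; compare box by box
    unfold settingDHVolSharp
    rw [thetaRegion3_thetaBoxDH]
    show (fun x => P.factorMap j x) ⁻¹' P.boxOf (sharpBoxDH X hlog t pp j) ⊆ P.comparison j ⁻¹' P.summandLatticeS j _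
    rw [P.factorMap_preimage_boxOf]
    refine Set.preimage_mono fun y hy => (P.mem_summandLatticeS_iff _ y).2 fun e => ?_
    have hy' : ∀ e, y e ∈ sharpBoxDH X hlog t pp j e := fun e => (Set.mem_univ_pi.1 hy) e
    by_cases he : e = e₀
    · -- the diagonal box: Prop. 1.2 (ii) at `φ = id`
      subst he
      rw [if_pos rfl]
      have hbox := hy' e₀
      unfold sharpBoxDH at hbox
      rw [labelIdele_labelSucc] at hbox
      exact iota_smul_normalizedPacket_subset_zpow_smul_logShell (pp : ℕ) (P.kk e₀) (two_le_card_caps_labelSucc X i₀)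
        (i := Fin.last _) (m := mΘ) (g := t pp i₀ x₀) hΘ hbox
    · -- any other box: absorbed by `C`
      rw [if_neg he]
      have hnorm : ∀ s : (Σ e : (thetaIndex X).Caps j → (thetaIndex X).Fibre (.inr pp), DIdx (pp : ℕ) (P.kk e)),
          ‖P.factorCoords j y s‖ ≤ ‖t pp i₀ xM‖ := by
        rintro ⟨e', i⟩
        have hbox := hy' e'
        unfold sharpBoxDH at hbox
        rw [labelIdele_labelSucc] at hbox
        exact (norm_dEquiv_le_of_mem_iota_smul_normalizedPacket (pp : ℕ) (P.kk e') (t pp i₀ (e' (Fin.last _))) hbox i).trans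
          (hxM _)
      have hmem : y ∈ P.factorCoords j ⁻¹' P.latticeF j C := hC _ hnorm
      rw [P.preimage_latticeF] at hmem
      exact (P.mem_summandLattice_iff C y).1 hmem e

end Summit.ABC.IUTFork.Thm311.Real

end

-- build-queue re-enqueue (comment-only re-land by abc-iut-w4-d014 g7, 2026-08-26T10:4xZ): declarations byte-identical to the
-- accepted tree copy (sha16 8f8a8263ebfdabfe); purpose: produce the missing olean (stranded accept) so that PENDING children deferred «no-olean» can verify.
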